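import Literature.AnabelianGeometry.AbsoluteAnabelian.AbsTopIII.KummerTowerLaws
import Literature.AnabelianGeometry.AbsoluteAnabelian.AbsTopIII.LinearSystems
import HarnessLib

/-!
# [AbsTopIII] §1: per-curve LAWS of the model interface, III — descent to `k̄_NF`: `K_{Z_NF} ⊆ K_{Z_{k̄}}`,
# the places of `K_{Z_NF}` (successor structure `DescentKummerModel extends TowerKummerModel`)

Mochizuki, *Topics in Absolute Anabelian Geometry III*, §1 (manuscript pages, lit key
`paper:url-5493eb38cbb7`): Def. 1.7 p. 35 ("`k̄_NF ⊆ k̄` the algebraic closure of `ℚ` in `k̄`"; (ii) "points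
of `X(k̄)` (respectively, rational functions on `X_{k̄}`; constant rational functions on `X_{k̄}` [i.e.,
which arise from elements of `k̄`]) that descend to `k̄_NF` [are] NF-points of (respectively, NF-rational
functions on; NF-constants on) `X_{k̄}`"); Thm. 1.9 (d) pp. 37–38 ("`K_{Z_NF}` is the function field of
the curve `Z_NF` obtained by descending `Z ×_{k_Z} k̄` to `k̄_NF`"); Thm. 1.9 (e) p. 38 ("the data of the
form described in Proposition 1.3, (a), (b), (c), arising from the construction of (d)") with Prop. 1.3
p. 30 ("(a) the [abstract!] group `K_X^×`; (b) the set of [surjective] homomorphisms `ord_x : K_X^× → ℤ`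
[...]; (c) [...] the subgroup `U_v ⊆ K_X^×` given by the `f ∈ K_X^×` such that `f(x) = 1`").

Third layer of the interface owner's successor structures (abc-iut-L4-t1; `KummerCurveLaws.lean`,
`KummerTowerLaws.lean`): the one-base-field interface types `NFFunctionField Z` ("`K_{Z_NF}`") as a
bare field and `IsNFRational` / `IsNFPoint` as primitives (cell abc-iut GAP-LEDGER G-w5d213-2 (d),
G-w5d213-3 (e0)–(e3)).  `DescentKummerModel extends TowerKummerModel` records, per curve `Z` of the model:

* (G) the geometric function field `K_{Z_{k̄}} = K_Z ⊗_{k_Z} k̄` (`geomField Z`) with the embeddings of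
  all finite levels `K_{Z ×_{k_Z} k′} ↪ K_{Z_{k̄}}` (`toGeom`, coherent along towers, exhausting) and of the
  constants `k̄ ↪ K_{Z_{k̄}}`;
* (NF) the descent `K_{Z_NF} ↪ K_{Z_{k̄}}` (`nfToGeom`) over `k̄_NF ↪ k̄`, the `k̄_NF`-algebra structure of
  `K_{Z_NF}` (`nfAlgebra`, DATA — no instance is declared), Def. 1.7 (ii) as an IMAGE CONDITION
  (`isNFRational_iff_mem_range`; abc-iut-w5-d213's `NFTower.fnEmb`/`nfEmb`/`isNFRational_iff`/`nfEmb_exhaust`),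
  (e0) `K_{Z_NF}/k̄_NF` is an algebraic function field of one variable of genus `g(Z)`;
* (P) the PLACES of `K_{Z_NF}` named by the `k′`-rational NF-points of the levels (`nfPlace`: (e1) every
  place is so named WHEN `Z` IS PROPER (v2, owner self-audit F-t1g5-1 — for an affine `Z` the places at
  the cusps are named by no point), names agree iff the points agree at a common level), with (e2) `ord`
  and (e3) "`f(x) = 1`" read at the level through the model's `ord` / `evalAt`.

Every field is an INTERFACE LAW (typing policy θ): TRUE at the intended étale-`π₁` model; NOT a published
prerequisite, NOT a named Prop fact; no instance is asserted.  HONEST FRAMING: statements-first interface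
laws; typed ≠ proved; nothing here bears on [IUTchIII] Cor. 3.12.
-/

noncomputable section

open CategoryTheory
open Literature.NumberTheory.DiophantineGeometry
open Literature.NumberTheory.DiophantineGeometry.AlgFunctionField
open scoped Classical Pointwise

namespace Literature.AnabelianGeometry.AbsoluteAnabelian.AbsTopIII

universe u

/-- **The model interface with its descent data to `k̄_NF`** (successor of `TowerKummerModel`; cell
abc-iut GAP-LEDGER G-w5d213-2 (d) / G-w5d213-3, interface owner abc-iut-L4-t1): a `TowerKummerModel`
TOGETHER WITH, for every curve `Z`, the geometric function field `K_{Z_{k̄}}` receiving all finite levels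
`K_{Z ×_{k_Z} k′}`, the descended function field "`K_{Z_NF}` [...] of the curve `Z_NF` obtained by descending
`Z ×_{k_Z} k̄` to `k̄_NF`" (Thm. 1.9 (d) p. 38) inside it over `k̄_NF ⊆ k̄`, Def. 1.7 (ii)'s "descend to
`k̄_NF`" as membership in `K_{Z_NF}`, and the places of `K_{Z_NF}/k̄_NF` named by rational NF-points of the
levels with their orders and values (the Prop.-1.3 data of Thm. 1.9 (e)).  INTERFACE (typing policy θ);
no instance is asserted. [cite: MochizukiAbsTopIII2015, Thm 1.9 (d) p.37] -/
structure DescentKummerModel : Type (u + 2) extends TowerKummerModel.{u} where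
  /-- (G) the geometric function field `K_{Z_{k̄}} = K_Z ⊗_{k_Z} k̄` of `Z ×_{k_Z} k̄` ("descending
  `Z ×_{k_Z} k̄`", Thm. 1.9 (d) p. 38). -/
  geomField : Curve → Type u
  /-- (G) `K_{Z_{k̄}}` is a field.  (Not registered as a global instance — statement files declare no
  instances; consumers write `letI := M.instGeomField Z`.) -/
  [instGeomField : ∀ Z, Field (geomField Z)]
  /-- (G) the finite levels inside it: `K_{Z ×_{k_Z} k′} ↪ K_{Z_{k̄}}` (abc-iut-w5-d213's `NFTower.fnEmb`). -/
  toGeom : ∀ {Z' Z : Curve}, IsBaseChangeOf Z' Z → (FunctionField Z' →+* geomField Z)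
  /-- (G) coherence along towers `Z″ → Z′ → Z`: `K_{Z′} ⊆ K_{Z″} ⊆ K_{Z_{k̄}}`. -/
  toGeom_comp_bcField : ∀ {Z'' Z' Z : Curve} (h₁ : IsBaseChangeOf Z'' Z') (h₂ : IsBaseChangeOf Z' Z)
    (h : IsBaseChangeOf Z'' Z), (toGeom h).comp (bcField h₁) = toGeom h₂
  /-- (G) the constants `k̄ ↪ K_{Z_{k̄}}`. -/
  geomBase : ∀ Z : Curve, AlgebraicClosure (base Z) →+* geomField Z
  /-- (G) constants of the levels are constants: `k′ → K_{Z′} → K_{Z_{k̄}}` is `k′ ⊆ k̄ ↪ K_{Z_{k̄}}`. -/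
  toGeom_algebraMap : ∀ {Z' Z : Curve} (h : IsBaseChangeOf Z' Z) (c' : base Z'),
    toGeom h (algebraMap (base Z') (FunctionField Z') c') = geomBase Z (bcEmb h c')
  /-- (G) `K_{Z_{k̄}} = ⋃_{k′} K_{Z ×_{k_Z} k′}`: every element is defined over some finite `k′`. -/
  geom_exhaust : ∀ (Z : Curve) (a : geomField Z),
    ∃ (Z' : Curve) (h : IsBaseChangeOf Z' Z) (g : FunctionField Z'), toGeom h g = a
  /-- (NF) "`K_{Z_NF}` is the function field of the curve `Z_NF` obtained by descending `Z ×_{k_Z} k̄` to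
  `k̄_NF`" (Thm. 1.9 (d) p. 38): `K_{Z_NF} ↪ K_{Z_{k̄}}` (abc-iut-w5-d213's `NFTower.nfEmb`). -/
  nfToGeom : ∀ Z : Curve, NFFunctionField Z →+* geomField Z
  /-- (NF) the `k̄_NF`-algebra structure of `K_{Z_NF}` (DATA; the curve `Z_NF` lives over `k̄_NF`). -/
  nfAlgebra : ∀ Z : Curve, Algebra (toCurveModel.kbarNF Z) (NFFunctionField Z)
  /-- (NF) `k̄_NF → K_{Z_NF} → K_{Z_{k̄}}` is `k̄_NF ⊆ k̄ ↪ K_{Z_{k̄}}`. -/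
  nfToGeom_algebraMap : ∀ (Z : Curve) (a : toCurveModel.kbarNF Z),
    nfToGeom Z (@algebraMap _ _ _ _ (nfAlgebra Z) a) =
      geomBase Z (a : AlgebraicClosure (base Z))
  /-- (NF) Def. 1.7 (ii) "rational functions on `X_{k̄}` [...] that descend to `k̄_NF`": for an NF-curve `Z`,
  `g ∈ K_{Z′}` is NF-rational iff `g ∈ K_{Z_NF}` inside `K_{Z_{k̄}}` (abc-iut-w5-d213's
  `NFTower.isNFRational_iff`). -/
  isNFRational_iff_mem_range : ∀ {Z' Z : Curve} (h : IsBaseChangeOf Z' Z), IsNFCurve Z →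
    ∀ g : FunctionField Z', IsNFRational Z' g ↔ toGeom h g ∈ Set.range (nfToGeom Z)
  /-- (e0) for a scheme-like NF-curve `Z`, `K_{Z_NF}/k̄_NF` is an algebraic function field of one variable
  ("the curve `Z_NF`"). -/
  nf_isAlgFunctionField : ∀ Z : Curve, IsNFCurve Z → IsScheme Z →
    @IsAlgFunctionField _ (NFFunctionField Z) _ _ (nfAlgebra Z)
  /-- (e0) descent preserves the genus: `g(K_{Z_NF}/k̄_NF) = g(Z)`. -/
  nf_genus : ∀ Z : Curve, IsNFCurve Z → IsScheme Z →
    @Literature.NumberTheory.DiophantineGeometry.AlgFunctionField.genus _ (NFFunctionField Z) _ _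
      (nfAlgebra Z) = genus Z
  /-- (P) the PLACE of `K_{Z_NF}/k̄_NF` named by a `k′`-RATIONAL NF-point `x′` of a level `Z′ = Z ×_{k_Z} k′`
  (its unique `k̄`-point descends to a `k̄_NF`-point of `Z_NF`; "NF-points `x_i ∈ U(k_x)`, where `k_x` is a
  finite extension of `k`", Prop. 1.8 (i) p. 36; the index set "`X(k)`" of Prop. 1.3 (b) for `X = Z_NF`). -/
  nfPlace : ∀ {Z' Z : Curve} (h : IsBaseChangeOf Z' Z) (x' : Point Z'),
    IsNFPoint Z' x' → IsRationalPt Z' x' → @PlaceOver _ (NFFunctionField Z) _ _ (nfAlgebra Z)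
  /-- (P) naming is compatible with refinement of the level: `x″ ↦ x′` under `Z″ → Z′` names the same place. -/
  nfPlace_bcPt : ∀ {Z'' Z' Z : Curve} (h₁ : IsBaseChangeOf Z'' Z') (h₂ : IsBaseChangeOf Z' Z)
    (h : IsBaseChangeOf Z'' Z) (x'' : Point Z'') (hx'' : IsNFPoint Z'' x'') (hr'' : IsRationalPt Z'' x'')
    (hx' : IsNFPoint Z' (bcPt h₁ x'')) (hr' : IsRationalPt Z' (bcPt h₁ x'')),
    nfPlace h₂ (bcPt h₁ x'') hx' hr' = nfPlace h x'' hx'' hr''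
  /-- (e1) equal names come from a common point at a common level ("`V` ranges over" all levels, Thm.
  1.9 (d): two rational NF-points name the same place of `K_{Z_NF}` iff they are images of one rational
  NF-point of a common base change). -/
  exists_common_of_nfPlace_eq : ∀ {Z₁ Z₂ Z : Curve} (h₁ : IsBaseChangeOf Z₁ Z)
    (h₂ : IsBaseChangeOf Z₂ Z) (x₁ : Point Z₁) (hx₁ : IsNFPoint Z₁ x₁) (hr₁ : IsRationalPt Z₁ x₁)
    (x₂ : Point Z₂) (hx₂ : IsNFPoint Z₂ x₂) (hr₂ : IsRationalPt Z₂ x₂),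
    nfPlace h₁ x₁ hx₁ hr₁ = nfPlace h₂ x₂ hx₂ hr₂ →
      ∃ (Z₃ : Curve) (g₁ : IsBaseChangeOf Z₃ Z₁) (g₂ : IsBaseChangeOf Z₃ Z₂) (x₃ : Point Z₃),
        bcPt g₁ x₃ = x₁ ∧ bcPt g₂ x₃ = x₂
  /-- (e1) for a PROPER scheme-like NF-curve `Z` ("`Z` is the canonical compactification", Thm. 1.9 (b)
  p. 37), every place of `K_{Z_NF}/k̄_NF` — i.e. every `k̄_NF`-point of the proper curve `Z_NF` — is named by a
  rational NF-point of some finite level ("for `k′` a[ny] finite extension of `k_Z`").  (v2, owner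
  self-audit F-t1g5-1: v1 omitted `IsProper Z`; for an AFFINE `Z` the finitely many places of `K_{Z_NF}` at
  the cusps are named by no point of any level, so v1 failed at the intended model; every consumer applies
  the law to the compactification `Z` of Thm. 1.9 (d), which is proper.) -/
  nfPlace_surjective : ∀ Z : Curve, IsNFCurve Z → IsScheme Z → IsProper Z →
    ∀ v : @PlaceOver _ (NFFunctionField Z) _ _ (nfAlgebra Z),
      ∃ (Z' : Curve) (h : IsBaseChangeOf Z' Z) (x' : Point Z') (hx' : IsNFPoint Z' x')
        (hr' : IsRationalPt Z' x'), nfPlace h x' hx' hr' = v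
  /-- (e2) ORDERS ("`ord_x : K_X^× → ℤ`", Prop. 1.3 (b)): the order at the named place of a descended
  function is its order at the naming point (base change of the base field is unramified). -/
  ord_nfPlace : ∀ {Z' Z : Curve} (h : IsBaseChangeOf Z' Z) (x' : Point Z') (hx' : IsNFPoint Z' x')
    (hr' : IsRationalPt Z' x') (g : (FunctionField Z')ˣ) (a : NFFunctionField Z),
    toGeom h (g : FunctionField Z') = nfToGeom Z a →
      @PlaceOver.ord _ (NFFunctionField Z) _ _ (nfAlgebra Z) (nfPlace h x' hx' hr') a =
        Multiplicative.toAdd (ord x' g)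
  /-- (e3) VALUES ("the subgroup `U_v ⊆ K_X^×` given by the `f ∈ K_X^×` such that `f(x) = 1`", Prop. 1.3
  (c) p. 30): a descended unit has value `1` at the named place iff its value at the naming rational point,
  read in a cofinite open `U′ ∋ x′` where it is a regular unit (`evalAt`), is `1`. -/
  mem_unitsWithValueOne_nfPlace_iff : ∀ {U' Z' Z : Curve} (h : IsBaseChangeOf Z' Z)
    (hU : IsCofiniteOpen U' Z') (x : Point U') (hx' : IsNFPoint Z' (ptRes hU x))
    (hr' : IsRationalPt Z' (ptRes hU x)) (hr : IsRationalPt U' x)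
    (g : toDivisorCurveModel.regularUnits U') (a : (NFFunctionField Z)ˣ),
    toGeom h ((fieldRes hU).symm ((g : (FunctionField U')ˣ) : FunctionField U')) =
        nfToGeom Z (a : NFFunctionField Z) →
      (a ∈ @unitsWithValueOne _ (NFFunctionField Z) _ _ (nfAlgebra Z) (nfPlace h _ hx' hr') ↔
        evalAt x hr g = 1)

end Literature.AnabelianGeometry.AbsoluteAnabelian.AbsTopIII
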